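import Mathlib.Algebra.Polynomial.AlgebraMap
import Mathlib.Algebra.Squarefree.Basic
import Literature.AlgebraicGeometry.Motives.GaloisRealization
import Literature.AlgebraicGeometry.Motives.ZetaFunction
import HarnessLib

/-!
# The generalized (coniveau) Tate conjecture over a finite field

J. S. Milne, N. Ramachandran, *Motivic complexes over finite fields and the ring of correspondences at
the generic point*, Pure Appl. Math. Q. 5 (2009) = arXiv:math/0607483 [MilneRamachandran2006], §1
"The generalized Tate conjecture" (read in the held text `arXiv:math/0607483`, chunk/line locators
below), following A. Grothendieck, *Le groupe de Brauer III*, §10.3, and J. Tate, *Conjectures on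
algebraic cycles in ℓ-adic cohomology*, PSPM 55 (1994) §1 [Tate1994]; restated as Thm. 1.4's
"Generalized Tate conjecture" in J. S. Milne, *The Tate conjecture over finite fields (AIM talk)*,
arXiv:0709.3040 [Milne2007TateFiniteFieldsAIM], §1.

This file TYPES, at statement level and in the vocabulary of the tree's hypothesis structure
`GaloisWeilCohomology k K χ` (`Motives/GaloisRealization`: a Weil cohomology theory on `k`-schemes with
a `K`-linear action `ρ` of `Gal(k̄/k)`; intended value: ℓ-adic étale cohomology of `X_{k̄}`), for a
FINITE field `k` with `q` elements:

* `E.frobenius X i` — the `K`-linear Frobenius map `ϖ_X` of `Hⁱ(X)`: the action of the GEOMETRIC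
  Frobenius `geomFrob k = φ⁻¹ ∈ Gal(k̄/k)` (`Motives/ZetaFunction`; Deligne, *Weil I*, (1.15):
  `F* = φ⁻¹` on `Hⁱ(X_{k̄}, ℚ_ℓ)`, the tree's `etaleCohomologyMap_frobenius_eq_geomFrob` in
  `Motives/FrobeniusGalois` for étale cohomology).
* `E.coniveauFiltration X i r` — `F^r_a Hⁱ(X)`, "the subspace of classes with support in codimension at
  least `r`" (§1.1), VERBATIM: the union (here: supremum — the family is directed) over the open
  `k`-subschemes `U ⊆ X` whose complement has codimension `≥ r` of `Ker(Hⁱ(X) → Hⁱ(U))`. This uses that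
  a `PreWeilCohomology` is a functor on ALL `k`-schemes (`Motives/PreWeilCohomology`), so `Hⁱ(U)` of an
  open subscheme is available; "codimension `≥ r`" is said pointwise: every point of `X` outside `U`
  has `Order.coheight ≥ r` in the specialization order (the codimension of its closure), the convention
  of `PreWeilCohomology.cycleClass`.
* `E.frobIntegralPart X i r` — `F^r_b Hⁱ(X)` of Remark 1.4: the largest `ϖ`-stable subspace on which
  `ϖ/q^r` is semisimple with algebraic-integer eigenvalues ("the subspace of `Hⁱ_l(X)` that becomes the
  sum of the eigenspaces of these `α` over `ℚ_l^{al}`", `α` running over the eigenvalues with `α/q^r` an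
  algebraic integer). Rendered WITHOUT passing to `K^{al}`: the supremum of the `ϖ`-stable `K`-subspaces
  `V` killed by `Q(q^{-r} ϖ)` for some MONIC `Q ∈ ℤ[T]` that is SQUAREFREE over `ℚ`. (Equivalence: if
  `ϖ/q^r` is semisimple on `V` with algebraic-integer eigenvalues, the product `Q` of the distinct minimal
  polynomials over `ℚ` of these eigenvalues is monic integral, squarefree over `ℚ`, and kills `ϖ/q^r` on
  `V`; conversely such a `Q` is separable in characteristic `0`, so `ϖ/q^r` is semisimple on `V` with
  eigenvalues among the roots of `Q`, which are algebraic integers. The supremum of such `V` is the sum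
  of the kernels `Ker P(q^{-r}ϖ)`, `P` running over the monic irreducible integer polynomials, i.e.
  exactly Remark 1.4's subspace.)
* `E.GeneralizedTateStatementFor X` — Conjecture 1.3 in the form displayed in Remark 1.4:
  `F^r_b Hⁱ(X) ⊂ F^r_a Hⁱ(X)` for all `i, r`. A `Prop`-valued PREDICATE on the data `(E, X)` (a
  definition; nothing is asserted), exactly as `E.TateConjectureFor X p` in `Motives/GaloisRealization`.

## The source, verbatim (arXiv:math/0607483, §1; chunk pNNNN Lk of the held text)

* p0003 L3: "In this section, `k` is the subfield `𝔽_q` of `𝔽`, and `l ≠ p`."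
* p0003 L31–L45: "Define a Tate structure to be a finite-dimensional `ℚ_l`-vector space with a linear
  (Frobenius) map `ϖ` whose characteristic polynomial lies in `ℚ[T]` and whose eigenvalues are Weil
  `q`-numbers […]. When the eigenvalues are all of weight `m` (resp. algebraic integers, resp.
  semisimple), we say that `V` is of weight `m` (resp. effective, resp. semisimple). For example, for
  any smooth complete variety `X` over `k`, `Hⁱ_l(X)` is an effective Tate structure of weight `i/2`
  ([deligne1980]), which is semisimple if `X` is an abelian variety ([weil1948], no. 70) or if the full
  Tate conjecture holds for `X × X` ([milne1986v], 8.6)."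
* p0003 L46–L55: "Let `X` be a smooth complete variety over `k`. For each `r`, let
  `F^r_a Hⁱ_l(X) ⊂ Hⁱ_l(X)` denote the subspace of classes with support in codimension at least `r`,
  i.e., `F^r_a Hⁱ_l(X) = ⋃_U Ker(Hⁱ_l(X) → Hⁱ_l(U))` where `U` runs over the open subvarieties of `X`
  such that `X ∖ U` has codimension `≥ r`."
* p0003 L71–L75: "Conjecture 1.3. (Generalized Tate conjecture; cf. [grothendieck1968], 10.3.). For a
  smooth complete variety `X` over `k`, every semisimple Tate substructure `V ⊂ Hⁱ_l(X)` such that `V(r)`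
  is still effective is contained in `F^r_a Hⁱ_l(X)`."
* p0003 L77–L88: "Remark 1.4. Let `X` be a smooth complete variety over `k`. For any `i` and `r`, the
  set of eigenvalues `α` of `ϖ_X` on `Hⁱ_l(X)` such that `α/q^r` is an algebraic integer is stable under
  Galois conjugation. Therefore, there is a subspace `F^r_b Hⁱ_l(X)` of `Hⁱ_l(X)` that becomes the sum
  of the eigenspaces of these `α` over `ℚ_l^{al}`. It is the largest semisimple Tate substructure of
  `Hⁱ_l(X)` whose twist by `ℚ_l(r)` is still effective, and so the generalized Tate conjecture (1.3) is
  the statement: `F^r_b Hⁱ_l(X) ⊂ F^r_a Hⁱ_l(X)`."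
* p0003 L91–L117 (Example 1.5, `i = 2r`): "Thus, the generalized Tate conjecture with `i = 2r` states
  that this subspace is spanned by the classes of algebraic cycles of codimension `r` on `X_𝔽`. This is
  the Tate conjecture stated over `𝔽` rather than `𝔽_q`."
* p0005 L1–L46 (Plain 1.14): by Deligne's Hodge II 8.2.8, its `l`-adic analogue and de Jong's
  alterations, `F^r_a Hⁱ_l(X) ⊂ F^r_b Hⁱ_l(X)` unconditionally; "The generalized Tate conjecture then
  states that `F^r_a Hⁱ_l(X) = F^r_b Hⁱ_l(X)`."

## Design choices / what is NOT here

* The subspaces are defined for every `k`-scheme `X` and all `i, r`; the conjecture is meaningful (and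
  intended) for `X` smooth projective, as in the source ("smooth complete"; the tree's Weil cohomology
  axioms are guarded by `IsSmoothProjective`). No smooth-projectivity hypothesis is put INTO the
  `Prop` (as for `TateConjectureFor`); users add it.
* `F^r_a` is the verbatim definition (kernels of restrictions to opens), NOT Plain 1.14's equivalent
  description by Gysin images from alterations (which is a theorem at the intended `E`, not a
  definition); in particular the unconditional inclusion `F^r_a ⊂ F^r_b` of Plain 1.14 is NOT provable
  for an abstract `E` and is not stated.
* `F^r_b` avoids eigenvalues in `K^{al}`: the integral-polynomial rendering above is equivalent to
  Remark 1.4's at every `E` (pure linear algebra over a field of characteristic zero), and keeps the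
  definition inside `K`.
* Theorem 1.10 / Corollary 1.11 of the source (Tate for all `A × X` ⟹ generalized Tate for `X`) are
  NOT here: they are recorded as a cited predicate in
  `Literature/AlgebraicGeometry/MilneRamachandran2006/GeneralizedTateFromTate.lean`. The `p`-adic
  analogue (Plain 1.15, `F`-isocrystals) and the number-field version (Plain 1.16) are not rendered.
* Mathlib searched: `Module.End` is a `K`-algebra (`Polynomial.aeval` on endomorphisms), `Squarefree`,
  `Polynomial.Monic`, `Polynomial.map`; there is no coniveau filtration or Tate structure in Mathlib.

## References

* [MilneRamachandran2006] §1: Plain 1.1, Conj. 1.3, Rem. 1.4, Ex. 1.5, Plain 1.14 (arXiv:math/0607483).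
* [Milne2007TateFiniteFieldsAIM] §1, Thm. 1.4 and the "Generalized Tate conjecture" displayed before it.
* [Tate1994] §1 (notation `T^r`, Tate twists). [Deligne1974] (1.15) (`F* = φ⁻¹`).
-/

noncomputable section

open CategoryTheory AlgebraicGeometry

universe u v

namespace Literature.AlgebraicGeometry.Motives

namespace GaloisWeilCohomology

variable {k : Type u} [Field k] {K : Type v} [Field K] [CharZero K]
  {χ : Field.absoluteGaloisGroup k →* Kˣ} (E : GaloisWeilCohomology k K χ)

/-! ### The coniveau filtration `F^r_a Hⁱ(X)` -/

/-- **The coniveau filtration** `F^r_a Hⁱ(X)` of Milne–Ramachandran 2006, §1.1 ("the subspace of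
classes with support in codimension at least `r`, i.e., `F^r_a Hⁱ_l(X) = ⋃_U Ker(Hⁱ_l(X) → Hⁱ_l(U))`
where `U` runs over the open subvarieties of `X` such that `X ∖ U` has codimension `≥ r`"): the
supremum, over the open immersions `j : U ⟶ X` of `k`-schemes such that every point of `X` outside
the image of `j` has coheight `≥ r` in the specialization order (= the codimension of its closure),
of `Ker(j* : Hⁱ(X) → Hⁱ(U))`. The family is directed (intersect two such opens), so the supremum is
the printed union at the intended `E`. [cite: MilneRamachandran2006, §1.1 (definition of F^r_a)] -/
def coniveauFiltration (X : SchemeOver k) (i r : ℕ) : Submodule K (E.obj X i) :=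
  ⨆ (U : SchemeOver k) (j : U ⟶ X) (_ : IsOpenImmersion j.left)
    (_ : ∀ x : X.left, x ∉ Set.range j.left.base → (r : ℕ∞) ≤ Order.coheight x),
    LinearMap.ker (E.pullback j i)

/-- A class killed by restriction to an open `U ⊆ X` whose complement has codimension `≥ r` lies in
`F^r_a Hⁱ(X)` (Milne–Ramachandran 2006, §1.1, the definition read as an introduction rule).
[cite: MilneRamachandran2006, §1.1] -/
theorem mem_coniveauFiltration {X : SchemeOver k} {i r : ℕ} {U : SchemeOver k} (j : U ⟶ X)
    (hj : IsOpenImmersion j.left)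
    (hcodim : ∀ x : X.left, x ∉ Set.range j.left.base → (r : ℕ∞) ≤ Order.coheight x)
    {c : E.obj X i} (hc : E.pullback j i c = 0) : c ∈ E.coniveauFiltration X i r := by
  have hker : c ∈ LinearMap.ker (E.pullback j i) := LinearMap.mem_ker.mpr hc
  exact Submodule.mem_iSup_of_mem U (Submodule.mem_iSup_of_mem j
    (Submodule.mem_iSup_of_mem hj (Submodule.mem_iSup_of_mem hcodim hker)))

/-- The coniveau filtration is decreasing in `r`: `F^s_a Hⁱ(X) ⊆ F^r_a Hⁱ(X)` for `r ≤ s` (an open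
whose complement has codimension `≥ s` has complement of codimension `≥ r`; Milne–Ramachandran
2006, §1.1). [cite: MilneRamachandran2006, §1.1] -/
theorem coniveauFiltration_antitone (X : SchemeOver k) (i : ℕ) :
    Antitone (E.coniveauFiltration X i) := by
  intro r s hrs
  refine iSup_mono fun U ↦ iSup_mono fun j ↦ iSup_mono fun hj ↦ iSup_le fun hcodim ↦ ?_
  have hcodim' : ∀ x : X.left, x ∉ Set.range j.left.base → (r : ℕ∞) ≤ Order.coheight x :=
    fun x hx ↦ (ENat.coe_le_coe.mpr hrs).trans (hcodim x hx)
  exact le_iSup_of_le hcodim' le_rfl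

/-! ### The Frobenius map and the effective-twist part `F^r_b Hⁱ(X)` -/

section Frobenius

variable [Finite k]

/-- **The Frobenius map `ϖ_X` of `Hⁱ(X)`** for a `k`-scheme `X`, `k` finite: the action of the
geometric Frobenius `geomFrob k = φ⁻¹ ∈ Gal(k̄/k)` (Milne–Ramachandran 2006, §1.1: the "linear
(Frobenius) map `ϖ`" of the Tate structure `Hⁱ_l(X)`; Deligne, Weil I, (1.15): `F* = φ⁻¹`).
[cite: MilneRamachandran2006, §1.1] -/
def frobenius (X : SchemeOver k) (i : ℕ) : E.obj X i →ₗ[K] E.obj X i :=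
  E.ρ X i (geomFrob k)

/-- Unfolding of `frobenius`. [cite: MilneRamachandran2006, §1.1] -/
theorem frobenius_apply (X : SchemeOver k) (i : ℕ) (x : E.obj X i) :
    E.frobenius X i x = E.ρ X i (geomFrob k) x := rfl

/-- The predicate "`V ⊆ Hⁱ(X)` is a `ϖ`-stable subspace on which `ϖ/q^r` is semisimple with
algebraic-integer eigenvalues" (Milne–Ramachandran 2006, Rem. 1.4: the twist `V(r)` is an effective
semisimple Tate structure), rendered inside `K`: `V` is stable under `ϖ = E.frobenius X i` and some
MONIC integer polynomial `Q`, SQUAREFREE over `ℚ`, satisfies `Q(q^{-r} ϖ) v = 0` for all `v ∈ V`,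
`q = #k` (see the module docstring for the equivalence with the printed wording).
[cite: MilneRamachandran2006, Rem. 1.4] -/
def IsEffectiveTwistSubspace (X : SchemeOver k) (i r : ℕ) (V : Submodule K (E.obj X i)) : Prop :=
  (∀ v ∈ V, E.frobenius X i v ∈ V) ∧
    ∃ Q : Polynomial ℤ, Q.Monic ∧ Squarefree (Q.map (Int.castRingHom ℚ)) ∧
      ∀ v ∈ V, Polynomial.aeval (((Nat.card k : K)⁻¹ ^ r) • E.frobenius X i)
        (Q.map (Int.castRingHom K)) v = 0

/-- **`F^r_b Hⁱ(X)`** (Milne–Ramachandran 2006, Rem. 1.4: "the subspace of `Hⁱ_l(X)` that becomes the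
sum of the eigenspaces of these `α` over `ℚ_l^{al}`", `α` the eigenvalues of `ϖ_X` with `α/q^r` an
algebraic integer; "the largest semisimple Tate substructure of `Hⁱ_l(X)` whose twist by `ℚ_l(r)` is
still effective"): the supremum of the `ϖ`-stable subspaces `V` on which `ϖ/q^r` is killed by a monic
integer polynomial squarefree over `ℚ` (`IsEffectiveTwistSubspace`).
[cite: MilneRamachandran2006, Rem. 1.4] -/
def frobIntegralPart (X : SchemeOver k) (i r : ℕ) : Submodule K (E.obj X i) :=
  ⨆ (V : Submodule K (E.obj X i)) (_ : E.IsEffectiveTwistSubspace X i r V), V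

/-- Every `ϖ`-stable subspace with effective semisimple `r`-th twist lies in `F^r_b Hⁱ(X)`
(Milne–Ramachandran 2006, Rem. 1.4: `F^r_b` is the largest such). [cite: MilneRamachandran2006, Rem. 1.4] -/
theorem le_frobIntegralPart {X : SchemeOver k} {i r : ℕ} {V : Submodule K (E.obj X i)}
    (hV : E.IsEffectiveTwistSubspace X i r V) : V ≤ E.frobIntegralPart X i r :=
  le_iSup_of_le V (le_iSup (fun _ : E.IsEffectiveTwistSubspace X i r V ↦ V) hV)

/-- `F^r_b Hⁱ(X)` is stable under the Frobenius map: `ϖ(F^r_b) ⊆ F^r_b` (a supremum of `ϖ`-stable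
subspaces; Milne–Ramachandran 2006, Rem. 1.4: it is a Tate substructure).
[cite: MilneRamachandran2006, Rem. 1.4] -/
theorem map_frobenius_frobIntegralPart_le (X : SchemeOver k) (i r : ℕ) :
    (E.frobIntegralPart X i r).map (E.frobenius X i) ≤ E.frobIntegralPart X i r := by
  unfold frobIntegralPart
  rw [Submodule.map_iSup]
  refine iSup_le fun V ↦ ?_
  rw [Submodule.map_iSup]
  refine iSup_le fun hV ↦ ?_
  exact (Submodule.map_le_iff_le_comap.mpr fun v hv ↦ hV.1 v hv).trans (E.le_frobIntegralPart hV)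

/-- Pointwise form: `x ∈ F^r_b Hⁱ(X) → ϖ x ∈ F^r_b Hⁱ(X)`. [cite: MilneRamachandran2006, Rem. 1.4] -/
theorem frobenius_mem_frobIntegralPart {X : SchemeOver k} {i r : ℕ} {x : E.obj X i}
    (hx : x ∈ E.frobIntegralPart X i r) : E.frobenius X i x ∈ E.frobIntegralPart X i r :=
  E.map_frobenius_frobIntegralPart_le X i r (Submodule.mem_map_of_mem hx)

/-! ### The conjecture -/

/-- **The generalized (coniveau) Tate statement `GT(X)` for the data `(E, X)`** — the inclusion
`F^r_b Hⁱ(X) ⊆ F^r_a Hⁱ(X)` for ALL `i` and `r` (Milne–Ramachandran 2006, the display of Rem. 1.4,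
equivalent form of their statement 1.3 = Grothendieck [Brauer III] 10.3 = the statement displayed
before Thm. 1.4 of Milne's AIM talk; the printed texts are quoted in the module docstring), for the
Galois–Weil cohomology `E` over the finite field `k` and the `k`-scheme `X` (intended: smooth
projective). For `i = 2r` it is Tate's statement `T^r` for `X` over `𝔽̄_q` (Ex. 1.5). A `Prop`-valued
PREDICATE on the data `(E, X)` — a definition in the standing of Tate's `T^p(X/k)` predicate of
`Motives/GaloisRealization`; nothing is asserted, and its truth value depends on the data `E`.
[cite: MilneRamachandran2006, Rem. 1.4 (display) and 1.3] -/
def GeneralizedTateStatementFor (X : SchemeOver k) : Prop :=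
  ∀ i r : ℕ, E.frobIntegralPart X i r ≤ E.coniveauFiltration X i r

/-- Unfolding of `GeneralizedTateStatementFor` (the display of Rem. 1.4). [cite: MilneRamachandran2006, Rem. 1.4] -/
theorem generalizedTateStatementFor_iff (X : SchemeOver k) :
    E.GeneralizedTateStatementFor X ↔
      ∀ i r : ℕ, E.frobIntegralPart X i r ≤ E.coniveauFiltration X i r :=
  Iff.rfl

variable {E} in
/-- Under `GT(X)`, every `ϖ`-stable subspace of `Hⁱ(X)` with effective semisimple `r`-th twist is
supported in codimension `≥ r` — the printed form of statement 1.3 (quantifying over the substructures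
`V`; text in the module docstring). [cite: MilneRamachandran2006, 1.3] -/
theorem GeneralizedTateStatementFor.le_coniveauFiltration {X : SchemeOver k}
    (h : E.GeneralizedTateStatementFor X) {i r : ℕ} {V : Submodule K (E.obj X i)}
    (hV : E.IsEffectiveTwistSubspace X i r V) : V ≤ E.coniveauFiltration X i r :=
  (E.le_frobIntegralPart hV).trans (h i r)

end Frobenius

end GaloisWeilCohomology

end Literature.AlgebraicGeometry.Motives

end
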